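import Summits.QuantumFields.YangMills.Theorems.BalabanUVNodesN11LocalIteratedAveraging
import Summits.QuantumFields.YangMills.Theorems.BalabanUVNodesN20ChiSemanticsCubes
import Literature.MathematicalPhysics.QuantumFieldTheory.Balaban1983to89.B15Prop1DatumSmall7AtZSequence

/-!
# DAG node N11 — THE JUNCTION'S TOP CLAUSE FROM `χ_k` AND SOLVABILITY: the box-closed hull of a cube top on the torus cover, and «`χ_k(Ω_k(s))(V) ≠ 0` + the (2.16)
# problems solvable inside `χ_k` ⇒ `V` is `2ε_k`-regular on every plaquette touching `Ω_k(s)^{(k)}`» (def-R's R-half of [RFACE-11d], regularity part, REDUCED TO K0's [15] row)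

HEADER — WORK-UNIT METADATA.  Cell `pub-ymgap`, YM-PLAN Track A (HUMAN RULING D-0062), seat `pub-ymgap-dag-n11-d` (g12; R134 fan-out seat N11 [B14], strategy s2),
route `BalabanUVNodes`, item K1⁷ `StabilityBAtRecordR13SepCoPH` = stmt-QuantumFields-20542 (helper, `--kind proof --supports 20542 --as helper`, count-neutral).
[III] = [Balaban1988Convergent], [B7] = [Balaban1985Averaging], [15] = [Balaban1985Variational], [I] = [Balaban1987RG1].  Over this seat's `…N11LocalIteratedAveraging`
(★★ LOCAL k-fold [B7] Prop. 2 on a box-closed family), dag-n20-d's `…N20ChiSemantics(Cubes)` (`plaqHol_eq_plaqHol_iter_ukBox` = p.267 l.5–7 constraint identity on the solvable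
set; `plaqSmallOn_ukBox_of_chiSeqOfRecord_ne_zero` = the literal semantics of `χ_k`; `pts_cubeEnl_subset`), dag-n21's `…N21LocalAveragedRegularity` (box regions), the cover ∕
cube dictionaries `B15Eq112TorusCover`, `B14.Eq213MaximalDomains.cubeExt`, `Node00.cubeEnl ∕ plaqInside ∕ cubeIndices`, `B15DeterminingSets.embIter ∕ pts`,
`B15Prop1DatumSmall7AtZSequence.embIter_add`, `T4Covariance`'s `Site.scaleTo ∕ scaleCoord`.

WHY THIS FILE.  The junction hJ of the no-expansion 𝐓-step (p591971 ∕ `…SpaceTruncationChargedSep`) asks at a charged separated index the TOP clause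
«`χ_k(s₀)(W_k) ≠ 0 ⇒ PlaqSmallOn (plaqsOf (genSet s₀.Ω k k)) (cR·ε_k) W_k`» — print's (2.10) «we assume that V_j is regular on Γ_j … it follows from the restrictions introduced by
the characteristic functions».  In the tree `χ_k` bounds the (2.16) MINIMISER `U_{k,□}(V)` by `ε_kη_k²` on `□^∼` only, and only «by junk» off the solvable set (n20-d).  This file
proves the clause AS A THEOREM RELATIVE TO SOLVABILITY: on the solvable set `V = M^k(U_{k,□}(V))` on the cube tops (p.267), and the LOCAL k-fold Proposition 2 carries the
`ε_kη_k²` bound up to `2ε_k` at scale `k` along the BOX-CLOSED HULL of the cube top, which stays inside `□^∼` when the cube is large against the averaging boxes.  The located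
price: `cR = 2` (K0a's numerics pin `cR := 1`; Prop. 2's leading term `L^{2k}·ε_kη_k² = ε_k` is first-order sharp, so `< 1·ε_k` is NOT derivable this way).

WHAT THIS FILE PROVES (0 `sorry`, 0 `def`).
§1 cover arithmetic: `cover_add_apply`, `scaleCoord_intCast`, `scaleTo_apply_of_intLabels` (`L^i·e`), ★ `cover_add_eq_embIter_add` (`z` covers `ι_k x` ⇒ `z + L^k·e` covers
   `ι_k(x + a)` for integer labels `e` of `a`), `zero_(un)shift_apply_eq_intCast`.
§2 ★★ `hull_boxClosed` (the hull family of a cube collar — scale-`i` plaquettes whose corner's iterated centre is covered by the collar of width `w₀ + R₀·Σ_{i≤l<k}L^l` — is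
   BOX-CLOSED DOWNWARD for n20-d's boxes `R₀ = (d+4)L+2`); `plaqsOf_pts_cubeEnl_subset_hullTop` (plaquettes touching `pts k □^{∼n}` ⊆ hull top of width `nS + L^k`);
   `hullBottom_subset_plaqInside` (hull bottom of width `m` ⊆ `plaqInside □^{∼n′}` when `m + 2 ≤ n′S`); `corners_mem_pts_cubeEnl` (the three corners read by `V(∂p)`).
§3 ★★★ `plaqSmallOn_plaqsOf_cubeTop_of_solvable_of_localSmall` — per cube: solvable + `α₀η_k²`-small background on `plaqInside □^∼` + numerics ⇒ `|V(∂p) − 1| < 2α₀` for every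
   `k`-plaquette touching `pts k □`.
§4 ★★★★ `plaqSmallOn_genSet_top_of_chiSeqOfRecord_ne_zero_of_solvable` — at NODE 00's `χ_k` of record: `χ_k(Ω_k(s))(V) ≠ 0` + per-cube solvability (K0 row) + cube cover of
   `Ω_k(s)` + numerics ⇒ `PlaqSmallOn (plaqsOf (genSet s.Ω k k)) (2ε_k) V`.

HONEST FRAMING.  Helper lane of K1⁷; lattice geometry + [B7] Props. 1–2 (in the tree) + n20-d's solvable-set identities; NOTHING of [III] ∕ [15] is asserted: SOLVABILITY of the
(2.16) problems on the χ-support is a HYPOTHESIS ([15] Thm 1's existence half = K0⁷'s print-stub territory), the cube cover `hcov` (⟸ `L·M₂ ∣ M`; fails at K0a's `M = M₂ = 1`: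
the `χ_k`-cubes `cubeSide = L^{k+1}M₂R_k` are then COARSER than the `𝐃_k`-cubes `dCubeSide = L^kMR_k` — located) and the side conditions are displayed.  The junction's
(7)-data half (`DataSmall7PTop`) is NOT touched.  N11 NOT discharged; K1⁷ NOT closed; counts unmoved (typed 28∕28 · discharged 5∕27).  One finite four-torus programme at fixed
`ε = L^{−K}` — NOT ℝ⁴, NOT OS, NOT a mass gap, NOT Clay.  No `sorry`, `axiom`, `def`, `instance`, `notation`.  Sources: [III] (2.10) p.256, (2.13) pp.256–257, (2.16)–(2.17) p.257,
p.267 l.5–7, (2.28) p.259; [B7] Prop. 1 (51) p.25–26, Prop. 2 (52)–(54) p.26; [15] Thm 1 (7)–(8) p.279; [I] (0.1) p.251; [Balaban1985RegularSpaces] p.77.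
-/

noncomputable section

open scoped BigOperators Matrix.Norms.L2Operator

namespace Summit.QuantumFields.YangMills.Theorems.BalabanUVNodesN11ChiTopRegularity

open Literature.MathematicalPhysics.QuantumFieldTheory.Balaban1983to89
open T4Continuum BlockAveraging AveragingRT ExpMeanLog BlockAveragingEMLProp2
open B15Eq112TorusCover (cover lift per cover_apply cover_lift cover_eq_cover_iff cover_add_pmul)
open B14DomainGeom (Pt)
open B14.Eq213MaximalDomains (cubeExt)
open B15DeterminingSets (embIter pts mem_pts)
open B15Prop1DatumSmall7AtZSequence (embIter_add)
open Node00 (cubeEnl)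
open Summit.QuantumFields.YangMills.BalabanUVNodes.N20LCSAvgDominationRegion (boxRegion mem_boxRegion mem_boxRegion_of_corner)

variable {P : Params}

/-! ## §1  Cover arithmetic: integer translates, the scaled vector of an integer offset, collars -/

/-- Widening a collar. [folklore] -/
private theorem cubeExt_mono_width {S : ℕ} (a : Pt P.d) {w w' : ℤ} (h : w ≤ w') : cubeExt S a w ⊆ cubeExt S a w' := by
  intro z hz i
  obtain ⟨h1, h2⟩ := hz i
  constructor <;> linarith

/-- A point coordinatewise within `w` of a collar point lies in the `w`-wider collar. [folklore] -/
private theorem mem_cubeExt_of_near {S : ℕ} {a z z' : Pt P.d} {r w : ℤ} (hz : z ∈ cubeExt S a r) (h : ∀ i, |z' i - z i| ≤ w) :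
    z' ∈ cubeExt S a (r + w) := by
  intro i
  obtain ⟨h1, h2⟩ := hz i
  have h3 := abs_le.1 (h i)
  constructor <;> linarith

/-- The cover of an integer translate, in coordinates (`Int.cast_add`). [cite: Balaban1987RG1, (0.1) p.251] -/
theorem cover_add_apply (z w : Pt P.d) (μ : Fin P.d) : cover P (z + w) μ = cover P z μ + ((w μ : ℤ) : ZMod (P.sitesPerDir 0)) := by
  rw [cover_apply, cover_apply, Pi.add_apply, Int.cast_add]

/-- `scaleCoord` on an integer label: `n ↦ L·n` reads `(e : ℤ∕N_{j+1}) ↦ (e·L : ℤ∕N_j)`. [cite: Balaban1987RG1, (0.1) p.251] -/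
theorem scaleCoord_intCast (j : ℕ) (e : ℤ) :
    Site.scaleCoord P j ((e : ZMod (P.sitesPerDir (j + 1)))) = ((e * P.L : ℤ) : ZMod (P.sitesPerDir j)) := by
  have h1 : ((e : ZMod (P.sitesPerDir (j + 1)))) = e • (1 : ZMod (P.sitesPerDir (j + 1))) := by rw [zsmul_eq_mul, mul_one]
  rw [h1, map_zsmul, Site.scaleCoord_one, zsmul_eq_mul, Int.cast_mul, Int.cast_natCast]

/-- `scaleTo i` on a site with INTEGER LABELS `e`: coordinates `L^i·e_ν` in `ℤ∕N_0`. [cite: Balaban1987RG1, (0.1) p.251] -/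
theorem scaleTo_apply_of_intLabels : ∀ (i : ℕ) (a : Site P i) (e : Fin P.d → ℤ), (∀ ν, a ν = ((e ν : ℤ) : ZMod (P.sitesPerDir i))) →
    ∀ ν, Site.scaleTo i a ν = ((((P.L : ℤ) ^ i * e ν : ℤ)) : ZMod (P.sitesPerDir 0))
  | 0, a, e, ha, ν => by rw [Site.scaleTo_zero, pow_zero, one_mul]; exact ha ν
  | i + 1, a, e, ha, ν => by
    rw [Site.scaleTo_succ]
    have h : ∀ ν, Site.scale a ν = (((e ν * P.L : ℤ)) : ZMod (P.sitesPerDir i)) := fun ν => by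
      rw [Site.scale_apply, ha ν, scaleCoord_intCast]
    rw [scaleTo_apply_of_intLabels i (Site.scale a) (fun ν => e ν * P.L) h ν]
    push_cast
    ring

/-- **MOVING THE COVER POINT WITH A STEP OF `T^{(k)}`**: if `z ∈ ℤᵈ` covers `ι_k x` and `a` has integer labels `e`, then `z + L^k·e` covers `ι_k (x + a)`
(`ι_k(x + a) = ι_k x + L^k·a`, `embIter_add`). [cite: Balaban1987RG1, (0.1) p.251] -/
theorem cover_add_eq_embIter_add (k : ℕ) {z : Pt P.d} {x : Site P k} (hz : cover P z = embIter k x) (a : Site P k) (e : Fin P.d → ℤ)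
    (ha : ∀ ν, a ν = ((e ν : ℤ) : ZMod (P.sitesPerDir k))) :
    cover P (z + fun ν => (P.L : ℤ) ^ k * e ν) = embIter k (x + a) := by
  funext μ
  rw [cover_add_apply, embIter_add, Site.add_apply, scaleTo_apply_of_intLabels k a e ha μ, ← hz]

/-- The unit step `e_μ` has integer labels `δ_μ`. [folklore] -/
theorem zero_shift_apply_eq_intCast {j : ℕ} (μ ν : Fin P.d) :
    ((0 : Site P j).shift μ) ν = (((Pi.single μ (1 : ℤ) : Fin P.d → ℤ) ν : ℤ) : ZMod (P.sitesPerDir j)) := by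
  by_cases h : ν = μ
  · subst h
    simp only [Site.shift, Function.update_self, Site.zero_apply, zero_add, Pi.single_eq_same, Int.cast_one]
  · simp only [Site.shift, Function.update_of_ne h, Site.zero_apply, Pi.single_eq_of_ne h, Int.cast_zero]

/-- The backward unit step `−e_μ` has integer labels `−δ_μ`. [folklore] -/
theorem zero_unshift_apply_eq_intCast {j : ℕ} (μ ν : Fin P.d) :
    ((0 : Site P j).unshift μ) ν = ((-((Pi.single μ (1 : ℤ) : Fin P.d → ℤ) ν) : ℤ) : ZMod (P.sitesPerDir j)) := by
  by_cases h : ν = μ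
  · subst h
    simp only [Site.unshift, Function.update_self, Site.zero_apply, zero_sub, Pi.single_eq_same, Int.cast_neg, Int.cast_one]
  · simp only [Site.unshift, Function.update_of_ne h, Site.zero_apply, Pi.single_eq_of_ne h, neg_zero, Int.cast_zero]

/-! ## §2  The box-closed hull of a cube collar at scale `k` -/

/-- **★ THE HULL FAMILY IS BOX-CLOSED DOWNWARD.**  For the `S`-cube of index `a₀`, a base width `w₀` and a top scale `k`, let the hull at scale `i` be the plaquettes of
`T^{(i)}` whose corner's iterated centre is covered by a point of the collar of width `w₀ + R₀·Σ_{i ≤ l < k} L^l` (`R₀ = (d+4)L + 2`, n20-d's box radius).  Then every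
plaquette of the box `boxRegion (emb q₋) R₀` of a hull plaquette `q ∈ T^{(i+1)}` is a hull plaquette of `T^{(i)}` (the offset `e`, `|e| ≤ R₀`, moves the cover point by
`L^i·e`). [cite: Balaban1987RG1, (0.1) p.251; Balaban1985Averaging, Prop. 1 p.25 («Δ(p′)»)] -/
theorem hull_boxClosed (S : ℕ) (a₀ : Pt P.d) (w₀ k : ℕ) :
    ∀ i, i < k → ∀ q ∈ {q : Plaq P (i + 1) | ∃ z ∈ cubeExt S a₀ ((w₀ + ((P.d + 4) * P.L + 2) * ∑ l ∈ Finset.Ico (i + 1) k, P.L ^ l : ℕ) : ℤ),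
        cover P z = embIter (i + 1) q.src},
      (↑(boxRegion (emb q.src) ((P.d + 4) * P.L + 2)) : Set (Plaq P i)) ⊆
        {q' : Plaq P i | ∃ z ∈ cubeExt S a₀ ((w₀ + ((P.d + 4) * P.L + 2) * ∑ l ∈ Finset.Ico i k, P.L ^ l : ℕ) : ℤ), cover P z = embIter i q'.src} := by
  intro i hi q hq q' hq'
  obtain ⟨z, hz, hzq⟩ := hq
  have hb := mem_boxRegion.mp (Finset.mem_coe.mp hq')
  choose e he using hb
  -- the scale-`i` offset `a := q'₋ − emb q₋` has integer labels `e`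
  have ha : ∀ ν, (q'.src - emb q.src) ν = ((e ν : ℤ) : ZMod (P.sitesPerDir i)) := fun ν => by
    show q'.src ν - emb q.src ν = _
    rw [(he ν).2, add_sub_cancel_left]
  refine ⟨z + fun ν => (P.L : ℤ) ^ i * e ν, ?_, ?_⟩
  · -- the translate stays in the wider collar
    have hsum : ((w₀ + ((P.d + 4) * P.L + 2) * ∑ l ∈ Finset.Ico (i + 1) k, P.L ^ l : ℕ) : ℤ) + ((((P.d + 4) * P.L + 2) * P.L ^ i : ℕ) : ℤ) =
        ((w₀ + ((P.d + 4) * P.L + 2) * ∑ l ∈ Finset.Ico i k, P.L ^ l : ℕ) : ℤ) := by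
      have hIco : ∑ l ∈ Finset.Ico i k, P.L ^ l = P.L ^ i + ∑ l ∈ Finset.Ico (i + 1) k, P.L ^ l :=
        Finset.sum_eq_sum_Ico_succ_bot hi _
      rw [hIco]
      push_cast
      ring
    rw [← hsum]
    refine mem_cubeExt_of_near hz fun ν => ?_
    rw [Pi.add_apply, add_sub_cancel_left, abs_mul, abs_pow, abs_of_nonneg (Int.natCast_nonneg P.L)]
    have hLi : (0 : ℤ) ≤ (P.L : ℤ) ^ i := pow_nonneg (Int.natCast_nonneg P.L) i
    calc (P.L : ℤ) ^ i * |e ν| ≤ (P.L : ℤ) ^ i * (((P.d + 4) * P.L + 2 : ℕ) : ℤ) := mul_le_mul_of_nonneg_left (he ν).1 hLi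
      _ = ((((P.d + 4) * P.L + 2) * P.L ^ i : ℕ) : ℤ) := by push_cast; ring
  · -- the cover of the translate is the iterated centre of the new corner
    rw [cover_add_eq_embIter_add i (x := emb q.src) hzq (q'.src - emb q.src) e ha, add_sub_cancel]

/-- **THE TOP OF THE HULL CONTAINS EVERY PLAQUETTE TOUCHING THE CUBE TOP**: a plaquette of `T^{(k)}` with a corner in `pts k (□^{∼n})` has its corner `p₋` covered by a point
of the collar of width `n·S + L^k` (one `k`-step is `L^k` fine units on the cover, in each coordinate). [cite: Balaban1985RegularSpaces, p.77 (convention before (1.5)); Balaban1987RG1, (0.1) p.251] -/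
theorem plaqsOf_pts_cubeEnl_subset_hullTop (S : ℕ) (a₀ : Pt P.d) (n k : ℕ) :
    B8Eq17ClassAkV1.plaqsOf (pts k (cubeEnl P S a₀ n)) ⊆
      {q : Plaq P k | ∃ z ∈ cubeExt S a₀ ((n * S + P.L ^ k : ℕ) : ℤ), cover P z = embIter k q.src} := by
  intro q hq
  -- from a touching corner `y` and an offset `a` with integer labels of size ≤ 1 and `q₋ = y + a`
  have key : ∀ (y a : Site P k) (v : Fin P.d → ℤ), y ∈ pts k (cubeEnl P S a₀ n) → (∀ ν, |v ν| ≤ 1) →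
      (∀ ν, a ν = ((v ν : ℤ) : ZMod (P.sitesPerDir k))) → q.src = y + a →
      ∃ z ∈ cubeExt S a₀ ((n * S + P.L ^ k : ℕ) : ℤ), cover P z = embIter k q.src := by
    intro y a v hy hv ha hsrc
    obtain ⟨z, hz, hzy⟩ := mem_pts.mp hy
    refine ⟨z + fun ν => (P.L : ℤ) ^ k * v ν, ?_, by rw [cover_add_eq_embIter_add k hzy a v ha, hsrc]⟩
    have hcast : ((n * S + P.L ^ k : ℕ) : ℤ) = ((n * S : ℕ) : ℤ) + (P.L : ℤ) ^ k := by push_cast; ring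
    rw [hcast]
    refine mem_cubeExt_of_near hz fun ν => ?_
    rw [Pi.add_apply, add_sub_cancel_left, abs_mul, abs_pow, abs_of_nonneg (Int.natCast_nonneg P.L)]
    have hLk : (0 : ℤ) ≤ (P.L : ℤ) ^ k := pow_nonneg (Int.natCast_nonneg P.L) k
    calc (P.L : ℤ) ^ k * |v ν| ≤ (P.L : ℤ) ^ k * 1 := mul_le_mul_of_nonneg_left (hv ν) hLk
      _ = (P.L : ℤ) ^ k := mul_one _
  have hne : q.μ ≠ q.ν := ne_of_lt q.hμν
  have hb1 : ∀ μ ν : Fin P.d, |(-((Pi.single μ (1 : ℤ) : Fin P.d → ℤ) ν))| ≤ 1 := fun μ ν => by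
    by_cases h : ν = μ
    · subst h; simp
    · simp [Pi.single_eq_of_ne h]
  rcases hq with h₀ | hμ | hν | hμν
  · exact key q.src 0 0 h₀ (fun ν => by simp) (fun ν => by simp [Site.zero_apply]) (add_zero _).symm
  · exact key (q.src.shift q.μ) ((0 : Site P k).unshift q.μ) _ hμ (hb1 q.μ) (zero_unshift_apply_eq_intCast q.μ)
      (by rw [Site.add_zero_unshift, Site.unshift_shift])
  · exact key (q.src.shift q.ν) ((0 : Site P k).unshift q.ν) _ hν (hb1 q.ν) (zero_unshift_apply_eq_intCast q.ν)
      (by rw [Site.add_zero_unshift, Site.unshift_shift])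
  · refine key ((q.src.shift q.μ).shift q.ν) ((0 : Site P k).unshift q.ν + (0 : Site P k).unshift q.μ)
      (fun ν => -((Pi.single q.ν (1 : ℤ) : Fin P.d → ℤ) ν) + -((Pi.single q.μ (1 : ℤ) : Fin P.d → ℤ) ν)) hμν (fun ν => ?_) (fun ν => ?_) ?_
    · by_cases h1 : ν = q.μ
      · subst h1; simp [Pi.single_eq_of_ne hne]
      · by_cases h2 : ν = q.ν
        · subst h2; simp [Pi.single_eq_of_ne h1]
        · simp [Pi.single_eq_of_ne h1, Pi.single_eq_of_ne h2]
    · rw [Site.add_apply, zero_unshift_apply_eq_intCast, zero_unshift_apply_eq_intCast, Int.cast_add]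
    · rw [← add_assoc, Site.add_zero_unshift, Site.add_zero_unshift, Site.unshift_shift, Site.unshift_shift]

/-- **THE BOTTOM OF THE HULL LIES IN `plaqInside` OF A WIDER COLLAR**: a fine plaquette whose corner is covered by a point of the collar of width `m` has all four
corners in `□^{∼n′}` as soon as `m + 2 ≤ n′·S`. [cite: Balaban1988Convergent, (2.17) p.257 («p ⊂ □^∼»)] -/
theorem hullBottom_subset_plaqInside (S : ℕ) (a₀ : Pt P.d) {m n' : ℕ} (h : m + 2 ≤ n' * S) :
    {q : Plaq P 0 | ∃ z ∈ cubeExt S a₀ (m : ℤ), cover P z = embIter 0 q.src} ⊆ Node00.plaqInside (cubeEnl P S a₀ n') := by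
  rintro q ⟨z, hz, hzq⟩
  have hzq' : cover P z = embIter 0 q.src := hzq
  -- every corner is `q₋` moved by an offset with integer labels of sup-size ≤ 2
  have corner : ∀ (a : Site P 0) (v : Fin P.d → ℤ), (∀ ν, |v ν| ≤ 2) → (∀ ν, a ν = ((v ν : ℤ) : ZMod (P.sitesPerDir 0))) →
      q.src + a ∈ cubeEnl P S a₀ n' := by
    intro a v hv ha
    refine ⟨z + fun ν => (P.L : ℤ) ^ 0 * v ν, ?_, cover_add_eq_embIter_add 0 hzq' a v ha⟩
    have hle : (m : ℤ) + 2 ≤ ((n' * S : ℕ) : ℤ) := by exact_mod_cast h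
    exact cubeExt_mono_width a₀ hle (mem_cubeExt_of_near hz fun ν => by
      rw [Pi.add_apply, add_sub_cancel_left, pow_zero, one_mul]; exact hv ν)
  have hne : q.μ ≠ q.ν := ne_of_lt q.hμν
  have hb1 : ∀ μ ν : Fin P.d, |((Pi.single μ (1 : ℤ) : Fin P.d → ℤ) ν)| ≤ 2 := fun μ ν => by
    by_cases hμν : ν = μ
    · subst hμν; simp
    · simp [Pi.single_eq_of_ne hμν]
  refine ⟨?_, ?_, ?_, ?_⟩
  · simpa using corner 0 0 (fun ν => by simp) (fun ν => by simp [Site.zero_apply])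
  · rw [← Site.add_zero_shift]
    exact corner _ _ (hb1 q.μ) (zero_shift_apply_eq_intCast q.μ)
  · rw [← Site.add_zero_shift]
    exact corner _ _ (hb1 q.ν) (zero_shift_apply_eq_intCast q.ν)
  · rw [← Site.add_zero_shift, ← Site.add_zero_shift, add_assoc]
    refine corner _ (fun ν => (Pi.single q.μ (1 : ℤ) : Fin P.d → ℤ) ν + (Pi.single q.ν (1 : ℤ) : Fin P.d → ℤ) ν) (fun ν => ?_) fun ν => ?_
    · by_cases h1 : ν = q.μ
      · subst h1; simp [Pi.single_eq_of_ne hne]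
      · by_cases h2 : ν = q.ν
        · subst h2; simp [Pi.single_eq_of_ne h1]
        · simp [Pi.single_eq_of_ne h1, Pi.single_eq_of_ne h2]
    · rw [Site.add_apply, zero_shift_apply_eq_intCast, zero_shift_apply_eq_intCast, Int.cast_add]

/-- **THE THREE CORNERS READ BY A PLAQUETTE VARIABLE LIE IN A WIDER COLLAR'S TOP**: if `p` touches `pts k (□^{∼n})`, then `p₋`, `p₋ + e_μ`, `p₋ + e_ν` lie in
`pts k (□^{∼n′})` as soon as `n·S + 2·L^k ≤ n′·S`. [cite: Balaban1985RegularSpaces, p.77; Balaban1987RG1, (0.1) p.251] -/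
theorem corners_mem_pts_cubeEnl (S : ℕ) (a₀ : Pt P.d) {n n' k : ℕ} (hn : n * S + 2 * P.L ^ k ≤ n' * S) {p : Plaq P k}
    (hp : p ∈ B8Eq17ClassAkV1.plaqsOf (pts k (cubeEnl P S a₀ n))) :
    p.src ∈ pts k (cubeEnl P S a₀ n') ∧ p.src.shift p.μ ∈ pts k (cubeEnl P S a₀ n') ∧ p.src.shift p.ν ∈ pts k (cubeEnl P S a₀ n') := by
  obtain ⟨z, hz, hzp⟩ := plaqsOf_pts_cubeEnl_subset_hullTop S a₀ n k hp
  -- moving from `p₋` by an offset with integer labels of size ≤ 1 stays in the `n′`-collar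
  have mv : ∀ (a : Site P k) (v : Fin P.d → ℤ), (∀ ν, |v ν| ≤ 1) → (∀ ν, a ν = ((v ν : ℤ) : ZMod (P.sitesPerDir k))) →
      p.src + a ∈ pts k (cubeEnl P S a₀ n') := by
    intro a v hv ha
    refine mem_pts.mpr ⟨z + fun ν => (P.L : ℤ) ^ k * v ν, ?_, cover_add_eq_embIter_add k hzp a v ha⟩
    have hle : ((n * S + P.L ^ k : ℕ) : ℤ) + (P.L : ℤ) ^ k ≤ ((n' * S : ℕ) : ℤ) := by
      have : ((n * S + 2 * P.L ^ k : ℕ) : ℤ) ≤ ((n' * S : ℕ) : ℤ) := by exact_mod_cast hn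
      push_cast at this ⊢
      linarith
    refine cubeExt_mono_width a₀ hle (mem_cubeExt_of_near hz fun ν => ?_)
    rw [Pi.add_apply, add_sub_cancel_left, abs_mul, abs_pow, abs_of_nonneg (Int.natCast_nonneg P.L)]
    have hLk : (0 : ℤ) ≤ (P.L : ℤ) ^ k := pow_nonneg (Int.natCast_nonneg P.L) k
    calc (P.L : ℤ) ^ k * |v ν| ≤ (P.L : ℤ) ^ k * 1 := mul_le_mul_of_nonneg_left (hv ν) hLk
      _ = (P.L : ℤ) ^ k := mul_one _
  have hb1 : ∀ μ ν : Fin P.d, |((Pi.single μ (1 : ℤ) : Fin P.d → ℤ) ν)| ≤ 1 := fun μ ν => by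
    by_cases hμν : ν = μ
    · subst hμν; simp
    · simp [Pi.single_eq_of_ne hμν]
  refine ⟨?_, ?_, ?_⟩
  · simpa using mv 0 0 (fun ν => by simp) (fun ν => by simp [Site.zero_apply])
  · rw [← Site.add_zero_shift]; exact mv _ _ (hb1 p.μ) (zero_shift_apply_eq_intCast p.μ)
  · rw [← Site.add_zero_shift]; exact mv _ _ (hb1 p.ν) (zero_shift_apply_eq_intCast p.ν)

/-! ## §3  The per-cube regularity: the local background small on `□^∼` + the (2.16) problem solvable ⇒ `V` regular on the plaquettes touching `□` -/

section PerCube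

open Node00 BalabanUVNodesN11LocalIteratedAveraging
open B14.Eq213MaximalDomains (side)
open B14.Eq213DetSet (Bj maxDomT)
open B14.Eq216Concrete (ukBox)
open B15DeterminingSets (avgFamily IsMinimizer)
open Literature.MathematicalPhysics.QuantumFieldTheory.BalabanImbrieJaffe1984to88.BIJ85Eq453GaugeField (qsstarGIter0)
open Summit.QuantumFields.YangMills.BalabanUVNodes.N20ChiSemantics (plaqHol_eq_plaqHol_iter_ukBox)
open Summit.QuantumFields.YangMills.BalabanUVNodes.N20ChiSemanticsCubes (pts_cubeEnl_subset)

variable {F : T4Family} {N : ℕ} [NeZero N]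

/-- **★★★ THE PER-CUBE TOP-SCALE REGULARITY FROM A LOCALLY SMALL (2.16) BACKGROUND.**  Let `□` be the `S`-cube of index `a₀` of the fine torus of the `K`-th run, `k ≤ m + K`
the scale, `U_{k,□}(V) = ukBox bg M₁ □^{∼4} k V` the (2.16) background of record (regularity class `εc·η_k²`, determining-set width `M₁`).  IF the (2.16) problem is SOLVABLE at
`V` (K0's row, [15] Thm 1's existence half — NOT asserted), the background is `α₀·η_k²`-small on the plaquettes INSIDE `□^∼` (what `χ_k(□) = 1` says, n20-d), the numerics
`C₀(d)α₀ ≤ ⅓`, `2α₀ ≤ c′₂` hold, and the cube is large against the averaging boxes (`L^k + R₀·Σ_{l<k} L^l + 2 ≤ S`, `R₀ = (d+4)L + 2`; with `3·L^kM₁ ≤ S`), THEN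
`|V(∂p) − 1| < 2α₀` for EVERY plaquette `p` of `T^{(k)}` touching the cube top `pts k □`.  Proof: `V(∂p) = M^k(U_{k,□}(V))(∂p)` on the constraint region (n20-d, p.267 l.5–7),
and the LOCAL k-fold Proposition 2 (`…N11LocalIteratedAveraging`) on the box-closed hull of `□`'s top (§2), whose bottom lies in `plaqInside □^∼`.
[cite: Balaban1988Convergent, (2.10) p.256, (2.16)–(2.17) p.257, p.267; Balaban1985Averaging, Prop. 1 (51) p.25, Prop. 2 (52)–(54) p.26] -/
theorem plaqSmallOn_plaqsOf_cubeTop_of_solvable_of_localSmall (K k : ℕ) (hk : k ≤ (F.P K).m + (F.P K).K) {S M₁ : ℕ} (a₀ : Pt (F.P K).d)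
    (hM : 1 ≤ M₁) (h3 : 3 * side (F.P K).L M₁ k ≤ S)
    (hR : (F.P K).L ^ k + (((F.P K).d + 4) * (F.P K).L + 2) * (∑ l ∈ Finset.range k, (F.P K).L ^ l) + 2 ≤ S)
    {εc α₀ : ℝ} (hα : 0 < α₀) (hα3 : (143 * (((((F.P K).d + 4 : ℕ) : ℝ)) ^ 2 / 4) ^ 2) * α₀ ≤ 1 / 3)
    (hα2 : 2 * α₀ ≤ 2 * deltaSU (Fin N) / ((((F.P K).d + 4) * (F.P K).L : ℕ) : ℝ) ^ 2)
    {V : GaugeField (F.P K) k (SU N)}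
    (hsolv : ∃ U₀, IsMinimizer (avOfRecord F N K) {U | PlaqSmall (εc * (F.P K).eta k ^ 2) U} (Bj M₁ (cubeEnl (F.P K) S a₀ 4) k)
      (avgFamily (avOfRecord F N K) (qsstarGIter0 k V)) U₀)
    (hloc : PlaqSmallOn (plaqInside (cubeEnl (F.P K) S a₀ 1)) (α₀ * (F.P K).eta k ^ 2)
      (ukBox (bgOfRecord (avOfRecord F N K) {U | PlaqSmall (εc * (F.P K).eta k ^ 2) U}) M₁ (cubeEnl (F.P K) S a₀ 4) k V)) :
    PlaqSmallOn (B8Eq17ClassAkV1.plaqsOf (pts k (cubeEnl (F.P K) S a₀ 0))) (2 * α₀) V := by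
  intro p hp
  -- the hull family of the cube top, base width `w₀ = 0·S + L^k`
  set Sf : (i : ℕ) → Set (Plaq (F.P K) i) := fun i =>
    {q | ∃ z ∈ cubeExt S a₀ ((0 * S + (F.P K).L ^ k + (((F.P K).d + 4) * (F.P K).L + 2) * ∑ l ∈ Finset.Ico i k, (F.P K).L ^ l : ℕ) : ℤ),
      cover (F.P K) z = embIter i q.src} with hSf
  have hS : ∀ i, i < k → ∀ q ∈ Sf (i + 1), (↑(boxRegion (emb q.src) (((F.P K).d + 4) * (F.P K).L + 2)) : Set (Plaq (F.P K) i)) ⊆ Sf i :=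
    hull_boxClosed S a₀ (0 * S + (F.P K).L ^ k) k
  -- the target plaquette is in the hull top
  have hpk : p ∈ Sf k := by
    obtain ⟨z, hz, hzp⟩ := plaqsOf_pts_cubeEnl_subset_hullTop S a₀ 0 k hp
    refine ⟨z, ?_, hzp⟩
    simpa only [Finset.Ico_self, Finset.sum_empty, mul_zero, add_zero] using hz
  -- the hull bottom lies inside `□^∼`, where `χ` bounds the background
  have h0 : Sf 0 ⊆ plaqInside (cubeEnl (F.P K) S a₀ 1) := by
    refine hullBottom_subset_plaqInside S a₀ ?_
    rw [one_mul, ← Finset.range_eq_Ico]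
    simpa only [zero_mul, zero_add] using hR
  have h52 : PlaqSmallOn (Sf 0) (α₀ * (F.P K).eta k ^ 2)
      (ukBox (bgOfRecord (avOfRecord F N K) {U | PlaqSmall (εc * (F.P K).eta k ^ 2) U}) M₁ (cubeEnl (F.P K) S a₀ 4) k V) :=
    fun q hq => hloc q (h0 hq)
  have havg := plaqSmallOn_iter_avOfRecord_of_boxClosed_top F N K k Sf hS hα hα3 hα2 h52 p hpk
  -- the three corners read by `V(∂p)` lie in the top-scale constraint region of `□^{∼4}`
  have hLS : 0 * S + 2 * (F.P K).L ^ k ≤ 3 * S := by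
    have hLk : (F.P K).L ^ k ≤ S := le_trans (Nat.le_add_right _ _) (le_trans (Nat.le_add_right _ _) hR)
    omega
  obtain ⟨c₀, cμ, cν⟩ := corners_mem_pts_cubeEnl S a₀ hLS hp
  have hsub := pts_cubeEnl_subset (F.P K) hM h3 a₀ 3
  rw [plaqHol_eq_plaqHol_iter_ukBox hk hsolv p (hsub c₀) (hsub cμ) (hsub cν)]
  exact havg

end PerCube

/-! ## §4  At NODE 00's `χ_k` of record: the junction's TOP clause on `Ω_k(s)` from `χ_k(s)(V) ≠ 0` + solvability of the (2.16) problems inside `χ_k` -/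

section Record

open Node00 B14.Eq218Concrete
open B14.Eq213MaximalDomains (side)
open B14.Eq213DetSet (Bj)
open B14.Eq216Concrete (ukBox)
open B15DeterminingSets (avgFamily IsMinimizer genSet gammaRegion_self)
open Literature.MathematicalPhysics.QuantumFieldTheory.BalabanImbrieJaffe1984to88.BIJ85Eq453GaugeField (qsstarGIter0)
open Summit.QuantumFields.YangMills.BalabanUVNodes.N20ChiSemantics (plaqSmallOn_ukBox_of_chiSeqOfRecord_ne_zero)

variable {F : T4Family} {N : ℕ} [NeZero N]

/-- A plaquette touching `pts k Y`, `Y` covered by a family of regions, touches `pts k` of one of them. [cite: Balaban1985RegularSpaces, p.77 (bookkeeping)] -/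
theorem exists_mem_plaqsOf_pts_of_subset_iUnion {P : Params} {ι : Type*} {k : ℕ} {Y : Set (Site P 0)} {A : Finset ι} {C : ι → Set (Site P 0)}
    (hY : Y ⊆ ⋃ a ∈ A, C a) {p : Plaq P k} (hp : p ∈ B8Eq17ClassAkV1.plaqsOf (pts k Y)) :
    ∃ a ∈ A, p ∈ B8Eq17ClassAkV1.plaqsOf (pts k (C a)) := by
  have pick : ∀ {x : Site P k}, x ∈ pts k Y → ∃ a ∈ A, x ∈ pts k (C a) := fun hx => by
    obtain ⟨a, ha, hxa⟩ := Set.mem_iUnion₂.mp (hY (mem_pts.mp hx))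
    exact ⟨a, ha, mem_pts.mpr hxa⟩
  rcases hp with h | h | h | h
  · obtain ⟨a, ha, hx⟩ := pick h; exact ⟨a, ha, Or.inl hx⟩
  · obtain ⟨a, ha, hx⟩ := pick h; exact ⟨a, ha, Or.inr (Or.inl hx)⟩
  · obtain ⟨a, ha, hx⟩ := pick h; exact ⟨a, ha, Or.inr (Or.inr (Or.inl hx))⟩
  · obtain ⟨a, ha, hx⟩ := pick h; exact ⟨a, ha, Or.inr (Or.inr (Or.inr hx))⟩

/-- **★★★★ THE JUNCTION'S TOP CLAUSE FROM `χ_k` AND SOLVABILITY** (def-R's R-half of [RFACE-11d], the regularity half): at step `k ≤ m + K` of the `K`-th run, for a (2.18)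
index `s` and a configuration `V` with `χ_k(Ω_k(s))(V) ≠ 0` ([III] (2.17)), IF the (2.16) problem of record is solvable at `V` on every `LM₂R_k`-cube `□ ⊂ Ω_k(s)` (K0's
row — [15] Thm 1's existence half, NOT asserted), `Ω_k(s)` is covered by those cubes (`hcov`; automatic when `𝐃_k`'s cubes — side `L^k·M·R_k` — are unions of `χ`-cubes — side
`L^{k+1}·M₂·R_k` —, i.e. `L·M₂ ∣ M`, print's «M a sufficiently large multiple»; NOT at K0a's `M = M₂ = 1`, located), and the
numerics hold (`ε_k` in Prop. 2's range; the cube side `S = L^k·M₂·R_k` against the boxes: `L^k + R₀·Σ_{l<k}L^l + 2 ≤ S`, `3·L^k·M₁ ≤ S`), THEN `V` is `2ε_k`-REGULAR ON EVERY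
PLAQUETTE OF `T^{(k)}` TOUCHING `Ω_k(s)^{(k)} = genSet s.Ω k k` — the junction's top clause with `cR = 2`.  (K0a's families pin `cR := 1`: located, the Prop. 2 factor is `2`.)
[cite: Balaban1988Convergent, (2.10) p.256, (2.16)–(2.17) p.257, p.267, (2.28) p.259; Balaban1985Averaging, Prop. 2 (52)–(54) p.26; Balaban1985Variational, Thm 1 (7)–(8) p.279] -/
theorem plaqSmallOn_genSet_top_of_chiSeqOfRecord_ne_zero_of_solvable (ν : Stage7Numerics) (M : ℕ) (g : ℕ → ℝ) (K k : ℕ)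
    (hk : k ≤ (F.P K).m + (F.P K).K) (s : SeqOfRecord F ν M g K k) (V : GaugeField (F.P K) k (SU N))
    (hχ : chiSeqOfRecord F N ν M g K k s V ≠ 0) (hM : 1 ≤ ν.M₁)
    (h3 : 3 * side (F.P K).L ν.M₁ k ≤ cubeSide (F.P K).L ν.M₂ (RkOfRecord (F.P K).L ν.r (g k)) k)
    (hR : (F.P K).L ^ k + (((F.P K).d + 4) * (F.P K).L + 2) * (∑ l ∈ Finset.range k, (F.P K).L ^ l) + 2 ≤
      cubeSide (F.P K).L ν.M₂ (RkOfRecord (F.P K).L ν.r (g k)) k)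
    (hε : 0 < epsOfRecord ν g k) (hε3 : (143 * (((((F.P K).d + 4 : ℕ) : ℝ)) ^ 2 / 4) ^ 2) * epsOfRecord ν g k ≤ 1 / 3)
    (hε2 : 2 * epsOfRecord ν g k ≤ 2 * deltaSU (Fin N) / ((((F.P K).d + 4) * (F.P K).L : ℕ) : ℝ) ^ 2)
    (hsolv : ∀ a ∈ cubesIn (fun a : ↥(cubeIndices (F.P K) (cubeSide (F.P K).L ν.M₂ (RkOfRecord (F.P K).L ν.r (g k)) k)) =>
        cubeEnl (F.P K) (cubeSide (F.P K).L ν.M₂ (RkOfRecord (F.P K).L ν.r (g k)) k) a 0) (s.Ω k),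
      ∃ U₀, IsMinimizer (avOfRecord F N K) {U | PlaqSmall (ν.εreg * (F.P K).eta k ^ 2) U}
        (Bj ν.M₁ (cubeEnl (F.P K) (cubeSide (F.P K).L ν.M₂ (RkOfRecord (F.P K).L ν.r (g k)) k) a 4) k)
        (avgFamily (avOfRecord F N K) (qsstarGIter0 k V)) U₀)
    (hcov : s.Ω k ⊆ ⋃ a ∈ cubesIn (fun a : ↥(cubeIndices (F.P K) (cubeSide (F.P K).L ν.M₂ (RkOfRecord (F.P K).L ν.r (g k)) k)) =>
        cubeEnl (F.P K) (cubeSide (F.P K).L ν.M₂ (RkOfRecord (F.P K).L ν.r (g k)) k) a 0) (s.Ω k),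
      cubeEnl (F.P K) (cubeSide (F.P K).L ν.M₂ (RkOfRecord (F.P K).L ν.r (g k)) k) a 0) :
    PlaqSmallOn (B8Eq17ClassAkV1.plaqsOf (genSet s.Ω k k)) (2 * epsOfRecord ν g k) V := by
  intro p hp
  have hp' : p ∈ B8Eq17ClassAkV1.plaqsOf (pts k (s.Ω k)) := by
    have e : genSet s.Ω k k = pts k (s.Ω k) := by
      show pts k (B15DeterminingSets.gammaRegion s.Ω k k) = _
      rw [gammaRegion_self]
    rwa [e] at hp
  obtain ⟨a, ha, hpa⟩ := exists_mem_plaqsOf_pts_of_subset_iUnion hcov hp'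
  exact plaqSmallOn_plaqsOf_cubeTop_of_solvable_of_localSmall K k hk (a : Pt (F.P K).d) hM h3 hR hε hε3 hε2 (hsolv a ha)
    (plaqSmallOn_ukBox_of_chiSeqOfRecord_ne_zero ν M g K k s V hχ a ha) p hpa

end Record

end Summit.QuantumFields.YangMills.Theorems.BalabanUVNodesN11ChiTopRegularity

end
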